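import Literature.Geometry.Lorentzian.CoordRicciEigenframe
import HarnessLib

/-!
# Pointwise structure of a three-dimensional Ricci form with eigenvalues `(0, a, a)`

Linear algebra at a point for metric components `G` (the `MetricCoord` layer) in dimension
three: if `Ric_x` has a `G_x`-orthonormal eigenframe `(e₀,e₁,e₂)` with eigenvalues `(0, a, a)`
(the "cylindrical" algebraic type of `S² × ℝ`, which is the type forced at every point of a
three-dimensional gradient shrinking soliton with `Ric ≥ 0` and a null vector, by
`ShrinkerPinchingEigenvalues`), then

* `ricAt_eq_of_null_eigenframe` — `Ric(W,Z) = a (G(W,Z) − G(e₀,W) G(e₀,Z))`, i.e.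
  `Ric = a (g − θ ⊗ θ)` with `θ = e₀^♭`;
* `IsMetricOn.apply_riemAt_null_frame_eq_zero`, `IsMetricOn.riemAt_null_eq_zero` — **the null
  direction is in the nullity of the curvature**: `R(W, e₀) = 0` for every `W` (in dimension three
  the Ricci form determines the curvature: Lee 2018, Prop. 8.32 / the sectional formula
  `CoordRicciEigenframe.two_mul_sec_eq_of_orthonormal_three`, and the off-diagonal components are
  Ricci components in an orthonormal frame).

Used for the soliton Codazzi identity `(∇_W Ric)(e₀, Z) − (∇_{e₀} Ric)(W, Z) = df(R(W,e₀)Z) = 0`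
in the proof that the null eigenvector field of such a soliton is parallel. Everything is proved;
no definitions are introduced.

## References

* J. M. Lee, *Introduction to Riemannian Manifolds*, 2nd ed., 2018, Prop. 8.32, Cor. 8.28. [Lee2018]
* B. O'Neill, *Semi-Riemannian geometry*, 1983, Ch. 3, Prop. 3.36, Lemma 3.52. [ONeill1983]
-/

noncomputable section

set_option maxSynthPendingDepth 3

open Set Module
open scoped Topology ContDiff

namespace Literature.Geometry.Lorentzian

namespace MetricCoord

variable {E : Type*} [NormedAddCommGroup E] [NormedSpace ℝ E] [FiniteDimensional ℝ E]
  [CompleteSpace E] {G : E → E →L[ℝ] E →L[ℝ] ℝ} {V : Set E} {x : E}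
  (e : Basis (Fin 3) ℝ E) (he : ∀ i j, G x (e i) (e j) = if i = j then 1 else 0)
  {a : ℝ} (hμ : ∀ i w, ricAt G x (e i) w = (if i = 0 then 0 else a) * G x (e i) w)
include he hμ

omit [CompleteSpace E] in
/-- **`Ric = a (g − θ⊗θ)`** for a Ricci form with orthonormal eigenframe of eigenvalues `(0,a,a)`:
`Ric(W,Z) = a (G(W,Z) − G(e₀,W) G(e₀,Z))`. [cite: ONeill1983, Ch. 3, Lemma 3.52] -/
theorem ricAt_eq_of_null_eigenframe (hs : ∀ v w, G x v w = G x w v) (W Z : E) :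
    ricAt G x W Z = a * (G x W Z - G x (e 0) W * G x (e 0) Z) := by
  have hW := sum_apply_smul_of_orthonormal e he W
  have hRic : ricAt G x W Z = ∑ i, G x W (e i) * ((if i = 0 then 0 else a) * G x (e i) Z) := by
    conv_lhs => rw [← hW]
    simp only [map_sum, map_smul, FunLike.coe_sum, Finset.sum_apply, FunLike.coe_smul,
      Pi.smul_apply, smul_eq_mul, hμ]
  have hGW : G x W Z = ∑ i, G x W (e i) * G x (e i) Z := by
    conv_lhs => rw [← hW]
    simp only [map_sum, map_smul, FunLike.coe_sum, Finset.sum_apply, FunLike.coe_smul,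
      Pi.smul_apply, smul_eq_mul]
  rw [hRic, hGW]
  simp only [Fin.sum_univ_three, Fin.isValue, if_true, show (1 : Fin 3) ≠ 0 from by decide,
    show (2 : Fin 3) ≠ 0 from by decide, if_false, hs W (e 0)]
  ring

/-- **All frame components `G(R(eᵢ,e₀)eⱼ, e_k)` vanish** for the null eigenvector `e₀` of a Ricci
form of type `(0,a,a)` in dimension three. [cite: Lee2018, Prop. 8.32] -/
theorem IsMetricOn.apply_riemAt_null_frame_eq_zero (hG : IsMetricOn G V) (hx : x ∈ V) (i j k : Fin 3) :
    G x (riemAt G x (e i) (e 0) (e j)) (e k) = 0 := by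
  -- Ricci values in the frame
  have hR : ∀ i j, ricAt G x (e i) (e j) = if i = j then (if i = 0 then 0 else a) else 0 :=
    fun i j ↦ ricAt_eigenframe_apply e he hμ i j
  -- symmetries
  have hZW : ∀ X Y Z W, G x (riemAt G x X Y W) Z = -G x (riemAt G x X Y Z) W :=
    fun X Y Z W ↦ hG.apply_riemAt_swap hx X Y Z W
  have hXY : ∀ X Y Z W, G x (riemAt G x Y X Z) W = -G x (riemAt G x X Y Z) W := fun X Y Z W ↦ by
    rw [riemAt_swap G x X Y]; simp
  have hPC : ∀ X Y Z W, G x (riemAt G x X Y Z) W = G x (riemAt G x Z W X) Y :=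
    fun X Y Z W ↦ hG.apply_riemAt_pair_comm hx X Y Z W
  have hXX : ∀ X Z W, G x (riemAt G x X X Z) W = 0 := fun X Z W ↦ by
    have h := hXY X X Z W; linarith
  have hZZ : ∀ X Y Z, G x (riemAt G x X Y Z) Z = 0 := fun X Y Z ↦ by
    have h := hZW X Y Z Z; linarith
  -- Ricci as a trace over the orthonormal frame
  have hTr : ∀ Y Z, ricAt G x Y Z = ∑ l, G x (riemAt G x (e l) Y Z) (e l) :=
    fun Y Z ↦ ricAt_eq_sum_of_orthonormal e he Y Z
  -- the sectional values `K(e₁,e₀) = K(e₂,e₀) = 0`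
  have hK1 : G x (riemAt G x (e 1) (e 0) (e 0)) (e 1) = 0 := by
    have h := hG.two_mul_sec_eq_of_orthonormal_three e he hx
    rw [hR, hR, hR] at h
    simp only [Fin.isValue, if_true, show (1 : Fin 3) ≠ 0 from by decide,
      show (2 : Fin 3) ≠ 0 from by decide, if_false] at h
    linarith
  have hK2 : G x (riemAt G x (e 2) (e 0) (e 0)) (e 2) = 0 := by
    set e' : Basis (Fin 3) ℝ E := e.reindex (Equiv.swap 1 2) with he'def
    have he'0 : e' 0 = e 0 := by rw [he'def, Basis.reindex_apply]; rfl
    have he'1 : e' 1 = e 2 := by rw [he'def, Basis.reindex_apply]; rfl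
    have he'2 : e' 2 = e 1 := by rw [he'def, Basis.reindex_apply]; rfl
    have he' : ∀ i j, G x (e' i) (e' j) = if i = j then 1 else 0 := fun i j ↦ by
      rw [he'def, Basis.reindex_apply, Basis.reindex_apply, he]
      simp only [Equiv.symm_swap, Equiv.apply_eq_iff_eq]
    have h := hG.two_mul_sec_eq_of_orthonormal_three e' he' hx
    rw [he'0, he'1, he'2, hR, hR, hR] at h
    simp only [Fin.isValue, if_true, show (1 : Fin 3) ≠ 0 from by decide,
      show (2 : Fin 3) ≠ 0 from by decide, if_false] at h
    linarith
  -- the mixed components are off-diagonal Ricci components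
  have h102 : G x (riemAt G x (e 1) (e 0) (e 0)) (e 2) = 0 := by
    -- `Ric(e₁,e₂) = Σ_l G(R(e_l,e₁)e₂, e_l) = G(R(e₀,e₁)e₂,e₀)`
    have h := hTr (e 1) (e 2)
    rw [hR, Fin.sum_univ_three] at h
    simp only [Fin.isValue, show (1 : Fin 3) ≠ 2 from by decide, if_false, hXX, hZZ,
      add_zero] at h
    -- `G(R(e₀,e₁)e₂,e₀) = G(R(e₁,e₀)e₀,e₂)`
    rw [hXY (e 1) (e 0) (e 2) (e 0), ← hZW (e 1) (e 0) (e 2) (e 0)] at h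
    linarith
  have h112 : G x (riemAt G x (e 1) (e 0) (e 1)) (e 2) = 0 := by
    -- `Ric(e₀,e₂) = G(R(e₁,e₀)e₂,e₁)`
    have h := hTr (e 0) (e 2)
    rw [hR, Fin.sum_univ_three] at h
    simp only [Fin.isValue, show (0 : Fin 3) ≠ 2 from by decide, if_false, hXX, hZZ,
      add_zero, zero_add] at h
    rw [hZW (e 1) (e 0) (e 1) (e 2)] at h
    linarith
  have h212 : G x (riemAt G x (e 2) (e 0) (e 1)) (e 2) = 0 := by
    -- `Ric(e₀,e₁) = G(R(e₂,e₀)e₁,e₂)`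
    have h := hTr (e 0) (e 1)
    rw [hR, Fin.sum_univ_three] at h
    simp only [Fin.isValue, show (0 : Fin 3) ≠ 1 from by decide, if_false, hXX, hZZ,
      zero_add] at h
    linarith
  have h201 : G x (riemAt G x (e 2) (e 0) (e 0)) (e 1) = 0 := by
    rw [hPC, hXY (e 1) (e 0) (e 2) (e 0), ← hZW (e 1) (e 0) (e 2) (e 0)]
    exact h102
  -- all cases
  fin_cases i
  · exact hXX _ _ _
  · fin_cases j <;> fin_cases k
    · exact hZZ _ _ _
    · exact hK1
    · exact h102
    · simpa [hZW (e 1) (e 0) (e 0) (e 1)] using hK1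
    · exact hZZ _ _ _
    · exact h112
    · simpa [hZW (e 1) (e 0) (e 0) (e 2)] using h102
    · simpa [hZW (e 1) (e 0) (e 1) (e 2)] using h112
    · exact hZZ _ _ _
  · fin_cases j <;> fin_cases k
    · exact hZZ _ _ _
    · exact h201
    · exact hK2
    · simpa [hZW (e 2) (e 0) (e 0) (e 1)] using h201
    · exact hZZ _ _ _
    · exact h212
    · simpa [hZW (e 2) (e 0) (e 0) (e 2)] using hK2
    · simpa [hZW (e 2) (e 0) (e 1) (e 2)] using h212
    · exact hZZ _ _ _

/-- **The null eigenvector is in the nullity of the curvature**: `R(W, e₀) = 0` for all `W`, for a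
Ricci form of type `(0,a,a)` in dimension three. [cite: Lee2018, Prop. 8.32, Cor. 8.28] -/
theorem IsMetricOn.riemAt_null_eq_zero (hG : IsMetricOn G V) (hx : x ∈ V) (W : E) :
    riemAt G x W (e 0) = 0 := by
  have hi := hG.isInvertible x hx
  have hcomp := hG.apply_riemAt_null_frame_eq_zero e he hμ hx
  have hPC : ∀ X Y Z W, G x (riemAt G x X Y Z) W = G x (riemAt G x Z W X) Y :=
    fun X Y Z W ↦ hG.apply_riemAt_pair_comm hx X Y Z W
  -- frame components with arbitrary last slots
  have h1 : ∀ i Z U, G x (riemAt G x (e i) (e 0) Z) U = 0 := by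
    intro i Z U
    conv_lhs => rw [← sum_apply_smul_of_orthonormal e he Z, ← sum_apply_smul_of_orthonormal e he U]
    simp only [map_sum, map_smul, FunLike.coe_sum, Finset.sum_apply, FunLike.coe_smul,
      Pi.smul_apply, smul_eq_mul, hcomp, mul_zero, Finset.sum_const_zero]
  -- linearity in `W` through pair symmetry
  have h2 : ∀ Z U, G x (riemAt G x W (e 0) Z) U = 0 := by
    intro Z U
    rw [hPC]
    conv_lhs => rw [← sum_apply_smul_of_orthonormal e he W]
    simp only [map_sum, map_smul, FunLike.coe_sum, Finset.sum_apply, FunLike.coe_smul,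
      Pi.smul_apply, smul_eq_mul]
    refine Finset.sum_eq_zero fun i _ ↦ ?_
    rw [← hPC, h1, mul_zero]
  ext Z
  have h3 : G x (riemAt G x W (e 0) Z) = 0 := by
    ext U; rw [h2]; rfl
  rw [_root_.zero_apply]
  exact hi.injective (h3.trans (map_zero (G x)).symm)

end MetricCoord

end Literature.Geometry.Lorentzian

end
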